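import Mathlib
import Literature.Geometry.DiscreteGeometry.TwoShellPatterns
import Literature.Probability.Process.RootedHardCoreConfig
import Summits.AtomisticToContinuum.Crystallization.Theorems.HullMinimalityLayeredWindowsGoodRegionDense
import Summits.AtomisticToContinuum.Crystallization.Theorems.HullMinimalityLayeredWindowsPatternCovering

/-!
# ChartedPlanarOrder · N `ChartedZeroExcessLayered` (stmt-AtomisticToContinuum-26636) — CLEAN CONFIGURATIONS ARE RELATIVELY DENSE
# (geometric half of lens-3's TRUE piece `WindowCounting` of the «RigidityDoor» node; decomp-a2c, prover hand 1, generation 7)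

`ChartedPlanarOrderRigidityDoor.WindowCounting` asks, for rooted hard-core configurations that are `(1/16, 9/10, 1)`-two-shell CLEAN at every
atom, for `≥ c₃ R³` atoms in every atom's `R`-window.  The geometric input is a COVERING RADIUS: this file proves that a separated configuration
which is `(1/16, 9/10, 1)`-two-shell good at every point is `5`-relatively dense — every point of space is within distance `< 5` of an atom.

* `cleanCovering_descent_ineq` — the descent arithmetic at tolerance `a/16`, scale `a ∈ [9/10, 1]`, covering cosine `2/11` and distance `r ≥ 5`:
  `d² ≤ a² − (4/11)·a·r + r² ⟹ d < r − a/16`.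
* `exists_mem_dist_lt_five_of_clean` — **COVERING**: for a `δ`-separated (`δ > 0`) nonempty `S ⊆ ℝ³` with `IsTwoShellGoodSet (1/16) (9/10) 1 S q`
  at every `q ∈ S`, every `y : ℝ³` has an atom `p ∈ S` with `dist p y < 5`.  Proof (the set version of lens-3's finite
  `LayeredWindowsLocal.stub_goodRegionDense`): the atom `p` nearest to `y` exists (local finiteness); if `dist p y ≥ 5`, pull `y − p` back through
  `p`'s isometry, cover it by a unit pattern vector `v` with cosine `≥ 2/11` (`LayeredWindowsLocal.stub_patternCovering`), and the atom labelled
  by `v` — within `a/16` of the ideal site `p + a•Av` — is strictly closer to `y`.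

No definitions, no `sorry`; `[folklore]`.
-/

noncomputable section

namespace Summit.AtomisticToContinuum.Crystallization.Theorems.ChartedPlanarOrderCleanCovering

open Metric Set
open scoped InnerProductSpace
open Literature.Geometry.DiscreteGeometry
open Summit.AtomisticToContinuum.Crystallization.Theorems.LayeredWindowsLocal
  (stub_patternCovering goodRegionDense_isometry_surjective goodRegionDense_norm_sq_expand)

/-- **Descent arithmetic** at tolerance `a/16`, scale `a ∈ [9/10, 1]`, covering cosine `2/11`, distance `r ≥ 5`:
`d² ≤ a² − (4/11)·a·r + r²` forces `d < r − a/16`. [folklore] -/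
theorem cleanCovering_descent_ineq {a r d : ℝ} (ha1 : 9 / 10 ≤ a) (ha2 : a ≤ 1) (hr : 5 ≤ r)
    (hd2 : d ^ 2 ≤ a ^ 2 - 2 * a * (2 / 11) * r + r ^ 2) : d < r - a / 16 := by
  have hpos : 0 < r - a / 16 := by linarith
  have hlt : d ^ 2 < (r - a / 16) ^ 2 := by nlinarith
  exact lt_of_pow_lt_pow_left₀ 2 hpos.le hlt

/-- **Clean separated configurations are `5`-relatively dense.** [folklore] -/
theorem exists_mem_dist_lt_five_of_clean {S : Set (EuclideanSpace ℝ (Fin 3))} {δ : ℝ} (hδ : 0 < δ)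
    (hsep : ∀ x ∈ S, ∀ y ∈ S, x ≠ y → δ ≤ dist x y) (hne : S.Nonempty)
    (hclean : ∀ q ∈ S, IsTwoShellGoodSet (1 / 16) (9 / 10) 1 S q) (y : EuclideanSpace ℝ (Fin 3)) :
    ∃ p ∈ S, dist p y < 5 := by
  classical
  obtain ⟨p₀, hp₀⟩ := hne
  -- the atoms at least as close to `y` as `p₀` form a finite nonempty set; pick the nearest one
  have hfin : (closedBall y (dist p₀ y) ∩ S).Finite :=
    Literature.Probability.Process.LocalConfig.finite_inter_of_separated hδ hsep (isCompact_closedBall _ _)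
  have hp₀K : p₀ ∈ hfin.toFinset := hfin.mem_toFinset.2 ⟨mem_closedBall.2 le_rfl, hp₀⟩
  obtain ⟨p, hpK, hpmin⟩ := Finset.exists_min_image hfin.toFinset (fun q => dist q y) ⟨p₀, hp₀K⟩
  have hpS : p ∈ S := (hfin.mem_toFinset.1 hpK).2
  have hple : dist p y ≤ dist p₀ y := hpmin p₀ hp₀K
  -- `p` is nearest among ALL atoms
  have hnear : ∀ q ∈ S, dist p y ≤ dist q y := by
    intro q hq
    by_cases hqK : q ∈ hfin.toFinset
    · exact hpmin q hqK
    · have : ¬ dist q y ≤ dist p₀ y := fun h => hqK (hfin.mem_toFinset.2 ⟨mem_closedBall.2 h, hq⟩)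
      exact hple.trans (le_of_lt (not_le.1 this))
  refine ⟨p, hpS, ?_⟩
  by_contra hfar
  rw [not_lt] at hfar
  obtain ⟨a, ha1, ha2, A, P, f, hP, hf, -, -⟩ := hclean p hpS
  -- cover `y - p`, pulled back through `A`, by a unit pattern vector with cosine ≥ 2/11
  obtain ⟨u', hu'⟩ := goodRegionDense_isometry_surjective A (y - p)
  obtain ⟨v, hvP, hv1, hvu⟩ := stub_patternCovering P hP u'
  have hyr : ‖y - p‖ = dist p y := by rw [← dist_eq_norm, dist_comm]
  have hnu' : ‖u'‖ = dist p y := by rw [← A.norm_map u', hu', hyr]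
  have hinner : ⟪A v, y - p⟫_ℝ = ⟪v, u'⟫_ℝ := by rw [← hu', A.inner_map_map]
  have hAv : ‖A v‖ = 1 := by rw [A.norm_map, hv1]
  have ha0 : 0 ≤ a := by linarith
  have hd2 : dist (p + a • A v) y ^ 2 ≤ a ^ 2 - 2 * a * (2 / 11) * dist p y + dist p y ^ 2 := by
    have h1 : dist (p + a • A v) y = ‖a • A v - (y - p)‖ := by
      rw [dist_eq_norm]
      congr 1
      abel
    rw [h1, goodRegionDense_norm_sq_expand (A v) (y - p) a hAv, hinner, hyr]
    rw [hnu'] at hvu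
    have h2 : a * (2 / 11 * dist p y) ≤ a * ⟪v, u'⟫_ℝ := mul_le_mul_of_nonneg_left hvu ha0
    linarith
  have hdesc : dist (p + a • A v) y < dist p y - a / 16 :=
    cleanCovering_descent_ineq ha1 ha2 hfar hd2
  obtain ⟨hfvS, hq⟩ := hf v hvP
  have hlt : dist (f v) y < dist p y :=
    calc dist (f v) y ≤ dist (f v) (p + a • A v) + dist (p + a • A v) y := dist_triangle _ _ _
      _ < 1 / 16 * a + (dist p y - a / 16) := add_lt_add_of_le_of_lt hq hdesc
      _ = dist p y := by ring
  exact absurd (hnear (f v) hfvS) (not_le.2 hlt)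

end Summit.AtomisticToContinuum.Crystallization.Theorems.ChartedPlanarOrderCleanCovering

end
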